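import Literature.NumberTheory.EllipticCurves.WeierstrassConjugateThreeTorsionProofs
import HarnessLib

/-!
# [IUTchIV] Proposition 1.8 (i) (Serre's criterion) in real form for elliptic curves:
# a Weierstrass automorphism acting trivially on the `l`-torsion, `l ≥ 3`, is the identity

`Proofs` file (theorems only; no definitions, no named facts, no instances) in topic
`NumberTheory/EllipticCurves`, companion of `WeierstrassAutFixedTorsionProofs` (a non-trivial
Weierstrass automorphism fixes only `2`- and `3`-torsion; a fixed point of order a power of a prime
`≥ 5` is `O`), `WeierstrassConjugateThreeTorsionProofs` (rigidity on a pair of independent `3`-torsion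
points; existence of such a pair) and `TorsionCardinality` (`#E[n] = n²`). Written by the cell
`abc-iut` (seat abc-iut-L5-t12) as the REAL form, for elliptic curves given by Weierstrass equations,
of

> S. Mochizuki, *Inter-universal Teichmüller theory IV*, Prop. 1.8 (i) ("Serre's Criterion"; kurims
> Apr-2020 manuscript, p. 18): "Let `l ≥ 3` be a prime number that is invertible in `k` … Then the
> natural map `φ : Aut_k̄(A, λ) → Aut(A[l])` … is injective"

in the elliptic-curve case the series uses ([Milne] Prop. 17.5; for elliptic curves this is the
fixed-point count behind Silverman *AEC* III.10.1): over an algebraically closed field `K` with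
`char K ∤ 6`, a change of variables `A` with `A • V = V` (an automorphism of the elliptic curve `V`)
whose induced automorphism of `V(K)` fixes every `l`-torsion point, `l ≥ 3` a prime invertible in
`K`, is `A = 1` (`VariableChange.eq_one_of_torsion_fixed`). The same statement is the rigidity step
inside `TorsionRationalDescentProofs` (Prop. 1.8 (iv) in real form); it is isolated here so that
consumers can cite (i) by name. Proof: `l = 3` — `eq_one_of_three_torsion_fixed` on the pair of
`exists_three_torsion_pair`; `l ≥ 5` — a non-trivial `A` would fix a non-zero point of `V[l]`
(`#V[l] = l² > 1`, `card_torsionBy_eq_sq`), contradicting `eq_zero_of_fixed_of_prime_pow_nsmul_eq_zero`.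

Deliberately NOT here: abelian varieties of dimension `> 1`, polarisations, the group structure on
`{A | A • V = V}` (the statement is the kernel form of injectivity).

## References

* [Mochizuki2012] S. Mochizuki, IUT IV, Prop. 1.8 (i) p. 18 (proof p. 19: "[Milne], Proposition 17.5").
* [Milne1986AbelianVarieties] J. S. Milne, *Abelian Varieties*, Prop. 17.5.
* [SilvermanAEC2009] J. H. Silverman, *The Arithmetic of Elliptic Curves*, 2nd ed., Thm. III.10.1,
  Cor. III.6.4(b).
-/

noncomputable section

open scoped Classical

universe u

namespace WeierstrassCurve

open Literature.NumberTheory.EllipticCurves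

variable {K : Type u} [Field K] [IsAlgClosed K] (V : WeierstrassCurve K) [V.IsElliptic]

/-- **[IUTchIV] Prop. 1.8 (i) (Serre's criterion), real form for elliptic curves.** Over an
algebraically closed field `K` with `char K ∤ 6`, let `A • V = V` be a change of variables
preserving the elliptic Weierstrass equation `V` whose induced automorphism of `V(K)` fixes every
`l`-torsion point, `l ≥ 3` a prime invertible in `K`. Then `A = 1` — i.e. `Aut(V) → Aut(V[l])` has
trivial kernel. (`l = 3`: rigidity on two independent `3`-torsion points; `l ≥ 5`: a non-trivial
automorphism fixes no non-zero point of `l`-power order, while `#V[l] = l² > 1`.)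
[cite: Milne1986AbelianVarieties, Prop 17.5] -/
theorem VariableChange.eq_one_of_torsion_fixed (h2 : (2 : K) ≠ 0) (h3 : (3 : K) ≠ 0) {l : ℕ}
    (hl : l.Prime) (hl3 : 3 ≤ l) (hlK : (l : K) ≠ 0) {A : VariableChange K} (hA : A • V = V)
    (hfix : ∀ T : V.toAffine.Point, (l : ℤ) • T = 0 →
      Affine.Point.congrEquiv hA (VariableChange.pointEquiv V A T) = T) :
    A = 1 := by
  by_cases hl3' : l = 3
  · -- `l = 3`: two independent `3`-torsion points
    subst hl3'
    obtain ⟨Q₁, Q₂, h3Q₁, h3Q₂, hQ₁0, hQ₂0, hne, hne'⟩ := exists_three_torsion_pair V h3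
    have h3Q₁' : ((3 : ℕ) : ℤ) • Q₁ = 0 := by rw [natCast_zsmul]; exact h3Q₁
    have h3Q₂' : ((3 : ℕ) : ℤ) • Q₂ = 0 := by rw [natCast_zsmul]; exact h3Q₂
    exact VariableChange.eq_one_of_three_torsion_fixed V h2 h3 hA h3Q₁ hQ₁0 hQ₂0 hne hne'
      (hfix Q₁ h3Q₁') (hfix Q₂ h3Q₂')
  · -- `l ≥ 5`: one non-zero `l`-torsion point suffices
    have hl4 : l ≠ 4 := by rintro rfl; exact absurd hl (by decide)
    have hl5 : 5 ≤ l := by omega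
    by_contra hA1
    have hcard : Nat.card (AddSubgroup.torsionBy V.toAffine.Point (l : ℤ)) = l ^ 2 :=
      card_torsionBy_eq_sq (E := V) hlK
    haveI : Finite (AddSubgroup.torsionBy V.toAffine.Point (l : ℤ)) :=
      Nat.finite_of_card_ne_zero (by rw [hcard]; positivity)
    have hnt : Nontrivial (AddSubgroup.torsionBy V.toAffine.Point (l : ℤ)) := by
      rw [← Finite.one_lt_card_iff_nontrivial, hcard]
      exact Nat.one_lt_pow two_ne_zero (by omega)
    obtain ⟨⟨Q, hQ⟩, hQ0⟩ := exists_ne (0 : AddSubgroup.torsionBy V.toAffine.Point (l : ℤ))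
    have hQ0' : Q ≠ 0 := fun h => hQ0 (Subtype.ext h)
    have hlQ : (l : ℤ) • Q = 0 := (Submodule.mem_torsionBy_iff (l : ℤ) Q).mp hQ
    have hlQ' : l ^ 1 • Q = 0 := by rw [pow_one, ← natCast_zsmul]; exact hlQ
    exact hQ0' (VariableChange.eq_zero_of_fixed_of_prime_pow_nsmul_eq_zero V h2 h3 hA hA1
      (hfix Q hlQ) hl hl5 hlQ')

/-- **Serre's criterion, injectivity form.** Two automorphisms `A • V = V`, `B • V = V` of an
elliptic Weierstrass equation over an algebraically closed field with `char ∤ 6` that induce the same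
map on the `l`-torsion points (`l ≥ 3` prime, invertible) are equal: apply
`eq_one_of_torsion_fixed` to `A⁻¹B`. [cite: Milne1986AbelianVarieties, Prop 17.5] -/
theorem VariableChange.eq_of_torsion_agree (h2 : (2 : K) ≠ 0) (h3 : (3 : K) ≠ 0) {l : ℕ}
    (hl : l.Prime) (hl3 : 3 ≤ l) (hlK : (l : K) ≠ 0) {A B : VariableChange K} (hA : A • V = V)
    (hB : B • V = V)
    (hagree : ∀ T : V.toAffine.Point, (l : ℤ) • T = 0 →
      Affine.Point.congrEquiv hA (VariableChange.pointEquiv V A T) =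
        Affine.Point.congrEquiv hB (VariableChange.pointEquiv V B T)) :
    A = B := by
  have hAB : (A⁻¹ * B) • V = V := by rw [mul_smul, hB, ← hA, inv_smul_smul, hA]
  suffices h1 : A⁻¹ * B = 1 by
    have := congrArg (A * ·) h1
    simpa [← mul_assoc] using this.symm
  refine VariableChange.eq_one_of_torsion_fixed V h2 h3 hl hl3 hlK hAB fun T hT => ?_
  rcases T with _ | ⟨x, y, hxy⟩
  · simp only [← Affine.Point.zero_def, map_zero]
  · have h := hagree (.some x y hxy) hT
    rw [VariableChange.pointEquiv_some, Affine.Point.congrEquiv_some, VariableChange.pointEquiv_some,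
      Affine.Point.congrEquiv_some, Affine.Point.some.injEq] at h
    rw [VariableChange.pointEquiv_some, Affine.Point.congrEquiv_some, Affine.Point.some.injEq]
    -- `(A⁻¹B)(x, y) = A⁻¹(B(x, y)) = A⁻¹(A(x, y)) = (x, y)`
    constructor
    · rw [toX_mul, ← h.1, ← toX_mul, inv_mul_cancel, toX_one]
    · rw [toY_mul, ← h.1, ← h.2, ← toY_mul, inv_mul_cancel, toY_one]

end WeierstrassCurve
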